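import Mathlib
import Summits.NavierStokesRegularity.NavierStokesRegularity.Theorems.EulerZoomLiouvillePowerGaugeEulerLiouvilleSelfSimilarTopBadNodeHyperbolic
import HarnessLib.Audit

/-!
# Rung C1 of the crux `EulerZoomLiouville.PowerGaugeEulerLiouville`: eigen-coordinate tools for the exit
# analysis along a stagnation arc (kernel line, lower growth bound)

Route №10 `EulerZoomLiouville` (NavierStokesRegularity), crux E = stmt-NavierStokesRegularity-19832,
tenure rung C1 (exactly self-similar members), registered residue `stub_selfSimilarExtremal`.
Seventh file of the NODAL-CONTINUUM line (lineage ns-typeII-p1, gen 7): linear-algebra inputs of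
`…SelfSimilarTopBadNodeArc` (the degenerate top bad node is not an interior point of a stagnation arc):

* `inner_apply_self_le_of_eigen'` — `⟪Aζ, ζ⟫ ≤ α p − μ m` in eigen-coordinates when the non-positive
  indices have `a_i ≤ −μ` OR vanishing coordinate;
* `sum_coord_velocity_ge` — the LOWER growth bound `Σ_{i∈I} 2⟪b i, ξ⟫⟪b i, −Aξ − E⟫ ≥ μ Σ ξ_i² − |E|²/μ`
  on such an index set (mirror of `sum_coord_velocity_le`);
* `kernel_coord_eq_zero_of_top` — for a symmetric `A` on `ℝ³` with a Rayleigh quotient `≥ β > 0` and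
  eigenvalue sum `< β`, the kernel is the line through a unit kernel vector `e`: exactly one eigenvalue
  vanishes and every `ξ ⊥ e` has zero coordinate there (at a bad non-vortical node: top eigenvalue
  `≥ 1+γ`, trace `3γ`).

WHAT THIS IS NOT: not NS, not E, not rung C1 — linear algebra. References: P. Constantin, M. Ignatova,
V. Vicol, arXiv:2602.17570 (2026), §3.5. [ConstantinIgnatovaVicol2026Putative]
-/

noncomputable section

-- flat `Theorems/<Route><Decl>…` files of one crux share the namespace of the crux (tree convention)
set_option linter.dupNamespace false

open Set Filter Topology Metric Function InnerProductSpace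
open scoped RealInnerProductSpace NNReal

namespace Summit.NavierStokesRegularity.NavierStokesRegularity.Theorems.PowerGaugeEulerLiouville.NodalContinuum

open Literature.Analysis Literature.Analysis.FluidPDE Literature.Analysis.ODE
open Summit.NavierStokesRegularity.NavierStokesRegularity.Theorems.PowerGaugeEulerLiouville.NodalFiniteness

variable {γ C : ℝ} {c : EuclideanSpace ℝ (Fin 3)}
  {U : EuclideanSpace ℝ (Fin 3) → EuclideanSpace ℝ (Fin 3)} {P : EuclideanSpace ℝ (Fin 3) → ℝ}

/-! ### Eigen-coordinates with a vanishing kernel coordinate -/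

section Eigen

variable {ι : Type*} [Fintype ι]

/-- `⟪Aζ, ζ⟫ ≤ α Σ_{a_i>0} ζ_i² − μ Σ_{a_i ≤ 0} ζ_i²` when `a_i ≤ α` for all `i`, and every index with
`a_i ≤ 0` has `a_i ≤ −μ` OR vanishing coordinate `ζ_i = 0`. [folklore] -/
theorem inner_apply_self_le_of_eigen'
    {A : EuclideanSpace ℝ (Fin 3) →L[ℝ] EuclideanSpace ℝ (Fin 3)}
    (hA : (A : EuclideanSpace ℝ (Fin 3) →ₗ[ℝ] EuclideanSpace ℝ (Fin 3)).IsSymmetric)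
    (b : OrthonormalBasis ι ℝ (EuclideanSpace ℝ (Fin 3))) {a : ι → ℝ} (hb : ∀ i, A (b i) = a i • b i)
    {α μ : ℝ} (hα : ∀ i, a i ≤ α) (ζ : EuclideanSpace ℝ (Fin 3))
    (hμ : ∀ i, ¬ 0 < a i → a i ≤ -μ ∨ ⟪b i, ζ⟫ = 0) :
    ⟪A ζ, ζ⟫ ≤ α * (∑ i ∈ Finset.univ.filter (fun i => 0 < a i), ⟪b i, ζ⟫ ^ 2) -
      μ * (∑ i ∈ Finset.univ.filter (fun i => ¬ 0 < a i), ⟪b i, ζ⟫ ^ 2) := by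
  classical
  rw [inner_apply_self_eq_sum_eigen hA b hb ζ,
    ← Finset.sum_filter_add_sum_filter_not Finset.univ (fun i => 0 < a i), Finset.mul_sum,
    Finset.mul_sum, sub_eq_add_neg, ← Finset.sum_neg_distrib]
  refine add_le_add (Finset.sum_le_sum fun i _ => ?_) (Finset.sum_le_sum fun i hi => ?_)
  · exact mul_le_mul_of_nonneg_right (hα i) (sq_nonneg _)
  · rw [Finset.mem_filter] at hi
    rcases hμ i hi.2 with h1 | h1
    · rw [← neg_mul]
      exact mul_le_mul_of_nonneg_right (by linarith) (sq_nonneg _)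
    · rw [h1]; simp

/-- **Lower growth bound in eigen-coordinates**: on an index set where `a_i ≤ −μ` (`μ > 0`) or the
coordinate vanishes, `Σ_{i∈I} 2⟪b i, ξ⟫⟪b i, −Aξ − E⟫ ≥ μ Σ_{i∈I}⟪b i, ξ⟫² − |E|²/μ`. [folklore] -/
theorem sum_coord_velocity_ge {A : EuclideanSpace ℝ (Fin 3) →L[ℝ] EuclideanSpace ℝ (Fin 3)}
    (hA : (A : EuclideanSpace ℝ (Fin 3) →ₗ[ℝ] EuclideanSpace ℝ (Fin 3)).IsSymmetric)
    (b : OrthonormalBasis (Fin 3) ℝ (EuclideanSpace ℝ (Fin 3))) {a : Fin 3 → ℝ}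
    (hb : ∀ i, A (b i) = a i • b i) {μ : ℝ} (hμ : 0 < μ) (I : Finset (Fin 3))
    (ξ E : EuclideanSpace ℝ (Fin 3)) (hI : ∀ i ∈ I, a i ≤ -μ ∨ ⟪b i, ξ⟫ = 0) :
    μ * (∑ i ∈ I, ⟪b i, ξ⟫ ^ 2) - ‖E‖ ^ 2 / μ ≤
      ∑ i ∈ I, 2 * ⟪b i, ξ⟫ * ⟪b i, -(A ξ) - E⟫ := by
  have hterm : ∀ i ∈ I, μ * ⟪b i, ξ⟫ ^ 2 - ⟪b i, E⟫ ^ 2 / μ ≤ 2 * ⟪b i, ξ⟫ * ⟪b i, -(A ξ) - E⟫ := by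
    intro i hi
    rw [inner_sub_right, inner_neg_right, inner_basis_apply_of_isSymmetric hA b hb ξ i]
    rcases hI i hi with h1 | h1
    · -- `2ξ(-aξ - e) = -2aξ² - 2ξe ≥ 2μξ² - (μξ² + e²/μ)`
      have h0 : 0 ≤ (μ * ⟪b i, ξ⟫ - ⟪b i, E⟫) ^ 2 / μ := by positivity
      have e1 : (μ * ⟪b i, ξ⟫ - ⟪b i, E⟫) ^ 2 / μ =
          μ * ⟪b i, ξ⟫ ^ 2 + ⟪b i, E⟫ ^ 2 / μ - 2 * (⟪b i, ξ⟫ * ⟪b i, E⟫) := by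
        field_simp
        ring
      have h2 : -(a i * ⟪b i, ξ⟫ ^ 2) ≥ μ * ⟪b i, ξ⟫ ^ 2 := by
        have := mul_le_mul_of_nonneg_right h1 (sq_nonneg ⟪b i, ξ⟫)
        linarith
      have e2 : 2 * ⟪b i, ξ⟫ * (-(a i * ⟪b i, ξ⟫) - ⟪b i, E⟫) =
          2 * (-(a i * ⟪b i, ξ⟫ ^ 2)) - 2 * (⟪b i, ξ⟫ * ⟪b i, E⟫) := by ring
      rw [e2]
      linarith
    · rw [h1]
      have : 0 ≤ ⟪b i, E⟫ ^ 2 / μ := by positivity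
      simp only [mul_zero, zero_mul, ne_eq, OfNat.ofNat_ne_zero, not_false_eq_true,
        zero_pow, zero_sub]
      linarith
  have hsumE : ∑ i ∈ I, ⟪b i, E⟫ ^ 2 / μ ≤ ‖E‖ ^ 2 / μ := by
    rw [← Finset.sum_div]
    exact div_le_div_of_nonneg_right (sum_sq_inner_filter_le b I E) hμ.le
  calc μ * (∑ i ∈ I, ⟪b i, ξ⟫ ^ 2) - ‖E‖ ^ 2 / μ
      ≤ μ * (∑ i ∈ I, ⟪b i, ξ⟫ ^ 2) - ∑ i ∈ I, ⟪b i, E⟫ ^ 2 / μ := by linarith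
    _ = ∑ i ∈ I, (μ * ⟪b i, ξ⟫ ^ 2 - ⟪b i, E⟫ ^ 2 / μ) := by
        rw [Finset.sum_sub_distrib, Finset.mul_sum]
    _ ≤ ∑ i ∈ I, 2 * ⟪b i, ξ⟫ * ⟪b i, -(A ξ) - E⟫ := Finset.sum_le_sum hterm

/-- **The kernel of the linearisation at a bad node is a line.**  `A` symmetric on `ℝ³`, eigenbasis `b`,
eigenvalues `a` with `Σ a_i < β`, `0 < β ≤ ⟪Aw, w⟫` for a unit `w`, `Ae = 0` for a unit `e`: exactly one
eigenvalue vanishes (`a_{i₀} = 0`) and `⟪b i₀, ξ⟫ = 0` for every `ξ ⊥ e` (two vanishing eigenvalues would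
leave the third equal to the sum `< β ≤` top eigenvalue). [folklore] -/
theorem kernel_coord_eq_zero_of_top {A : EuclideanSpace ℝ (Fin 3) →L[ℝ] EuclideanSpace ℝ (Fin 3)}
    (hA : (A : EuclideanSpace ℝ (Fin 3) →ₗ[ℝ] EuclideanSpace ℝ (Fin 3)).IsSymmetric)
    (b : OrthonormalBasis (Fin 3) ℝ (EuclideanSpace ℝ (Fin 3))) {a : Fin 3 → ℝ}
    (hb : ∀ i, A (b i) = a i • b i) {β : ℝ} (hβ : 0 < β) (hsum : ∑ i, a i < β)
    (hw : ∃ w : EuclideanSpace ℝ (Fin 3), ‖w‖ = 1 ∧ β ≤ ⟪A w, w⟫)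
    {e : EuclideanSpace ℝ (Fin 3)} (he1 : ‖e‖ = 1) (hAe : A e = 0) :
    ∃ i₀ : Fin 3, a i₀ = 0 ∧ (∀ i, i ≠ i₀ → a i ≠ 0) ∧
      ∀ ξ : EuclideanSpace ℝ (Fin 3), ⟪e, ξ⟫ = 0 → ⟪b i₀, ξ⟫ = 0 := by
  classical
  -- coordinates of `e`: `a i * ⟪b i, e⟫ = 0`
  have hcoord : ∀ i, a i * ⟪b i, e⟫ = 0 := by
    intro i
    rw [← inner_basis_apply_of_isSymmetric hA b hb e i, hAe, inner_zero_right]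
  -- some eigenvalue vanishes
  have hex : ∃ i₀, a i₀ = 0 := by
    by_contra hne
    push Not at hne
    have h0 : ∀ i, ⟪b i, e⟫ = 0 := fun i =>
      (mul_eq_zero.1 (hcoord i)).resolve_left (hne i)
    have : ‖e‖ ^ 2 = 0 := by
      rw [← b.sum_sq_inner_right e]
      exact Finset.sum_eq_zero fun i _ => by rw [h0 i]; ring
    rw [he1] at this
    norm_num at this
  obtain ⟨i₀, hi₀⟩ := hex
  -- the top index
  obtain ⟨w, hw1, hw⟩ := hw
  obtain ⟨j, -, hj⟩ := Finset.exists_max_image Finset.univ a Finset.univ_nonempty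
  have htop : β ≤ a j := by
    have : ⟪A w, w⟫ ≤ a j := by
      rw [inner_apply_self_eq_sum_eigen hA b hb w]
      calc ∑ i, a i * ⟪b i, w⟫ ^ 2 ≤ ∑ i, a j * ⟪b i, w⟫ ^ 2 :=
            Finset.sum_le_sum fun i _ => mul_le_mul_of_nonneg_right (hj i (Finset.mem_univ _))
              (sq_nonneg _)
        _ = a j * ‖w‖ ^ 2 := by rw [← Finset.mul_sum, b.sum_sq_inner_right]
        _ = a j := by rw [hw1]; ring
    exact hw.trans this
  -- uniqueness of the vanishing eigenvalue
  have huniq : ∀ i, i ≠ i₀ → a i ≠ 0 := by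
    intro i hii₀ hai
    have hji₀ : j ≠ i₀ := by
      rintro rfl; rw [hi₀] at htop; linarith [hβ]
    have hji : j ≠ i := by
      rintro rfl; rw [hai] at htop; linarith [hβ]
    -- `univ.erase j = {i₀, i}`
    have hsub : ({i₀, i} : Finset (Fin 3)) ⊆ Finset.univ.erase j := by
      intro k hk
      rw [Finset.mem_insert, Finset.mem_singleton] at hk
      rw [Finset.mem_erase]
      rcases hk with rfl | rfl
      · exact ⟨hji₀.symm, Finset.mem_univ _⟩
      · exact ⟨hji.symm, Finset.mem_univ _⟩
    have hcard : (Finset.univ.erase j : Finset (Fin 3)).card ≤ ({i₀, i} : Finset (Fin 3)).card := by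
      rw [Finset.card_erase_of_mem (Finset.mem_univ _), Finset.card_univ, Fintype.card_fin,
        Finset.card_pair hii₀.symm]
    have heq : ({i₀, i} : Finset (Fin 3)) = Finset.univ.erase j :=
      Finset.eq_of_subset_of_card_le hsub hcard
    have hsplit : ∑ k, a k = a j + ∑ k ∈ Finset.univ.erase j, a k :=
      (Finset.add_sum_erase Finset.univ a (Finset.mem_univ j)).symm
    rw [← heq, Finset.sum_pair hii₀.symm, hi₀, hai] at hsplit
    linarith
  refine ⟨i₀, hi₀, huniq, fun ξ hξ => ?_⟩
  -- `⟪b i, e⟫ = 0` for `i ≠ i₀`, so `e = ⟪b i₀, e⟫ b i₀` and `⟪e, ξ⟫ = ⟪b i₀, e⟫ ⟪b i₀, ξ⟫`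
  have h0 : ∀ i, i ≠ i₀ → ⟪b i, e⟫ = 0 := fun i hi =>
    (mul_eq_zero.1 (hcoord i)).resolve_left (huniq i hi)
  have hexp : ⟪e, ξ⟫ = ⟪e, b i₀⟫ * ⟪b i₀, ξ⟫ := by
    rw [← b.sum_inner_mul_inner e ξ, ← Finset.add_sum_erase Finset.univ _ (Finset.mem_univ i₀)]
    have : ∑ k ∈ Finset.univ.erase i₀, ⟪e, b k⟫ * ⟪b k, ξ⟫ = 0 := by
      refine Finset.sum_eq_zero fun k hk => ?_
      rw [Finset.mem_erase] at hk
      rw [real_inner_comm (b k) e, h0 k hk.1, zero_mul]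
    rw [this, add_zero]
  have hne : ⟪e, b i₀⟫ ≠ 0 := by
    intro hz
    have : ‖e‖ ^ 2 = 0 := by
      rw [← b.sum_sq_inner_right e, ← Finset.add_sum_erase Finset.univ _ (Finset.mem_univ i₀)]
      have h1 : ∑ k ∈ Finset.univ.erase i₀, ⟪b k, e⟫ ^ 2 = 0 := by
        refine Finset.sum_eq_zero fun k hk => ?_
        rw [Finset.mem_erase] at hk
        rw [h0 k hk.1]; ring
      rw [h1, add_zero, real_inner_comm e (b i₀), hz]; ring
    rw [he1] at this; norm_num at this
  rw [hξ] at hexp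
  exact (mul_eq_zero.1 hexp.symm).resolve_left hne

end Eigen

end Summit.NavierStokesRegularity.NavierStokesRegularity.Theorems.PowerGaugeEulerLiouville.NodalContinuum
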